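/-
Copyright (c) 2026 the pub-hodgecm2 formalisation cell (harness21).  New file, not vendored.
Origin: (c-S.1) RE-KEY error wave, pair «subcorner» seat «b» (prover-pub-hodgecm2-rekey-l1-subcorner-b-g0-0), 2026-08-23 (HOME INBOX l.11881 FACT 1).
KERNEL ONLY (3 theorems, 0 defs, nothing cited): over a presentation of record `hV : (mk ι₁).embedding = ι₁` the conjugate embedding
`ῑ₁ := conj ∘ ι₁` is NOT the canonical representative of its place (`mk ῑ₁ = mk ι₁`), hence NO seesaw context is `SInstance.GOG` for a hermitian
space presented at `ῑ₁`: the OG-guarded theta supply (`hG_GOG`, `hpos_GOG`, `SROG`, the `_r21AEOG` chain) speaks only at the canonical `ι₁`.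
Bearing on the re-key: a GOG-flipped junction head (`HThetaJunctionR2B′ §3`, `R2BGal′ §3`) is vacuous over `(V, ι₁, hV)`; together with
`SignRecipe.GoodCtx.not_jointFlip` (`Rekey/Binders/LiftTypeConj`) this makes the primed junction STRUCTURAL, not a token wave.
HELD pending orientation re-key; HC_CM is NOT proved; NOT «Δ2 BRIDGE CLOSED».
-/
import Summits.HodgeConjecture.HodgeCM.Model.ThetaAdelicSideReadOff

set_option autoImplicit false

noncomputable section

open NumberField NumberField.ComplexEmbedding NumberField.InfinitePlace
open scoped ComplexConjugate

/-!
# No OG guard at the conjugate embedding over a presentation of record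

Over `hV : (mk ι₁).embedding = ι₁` the conjugate embedding `ῑ₁ := conj ∘ ι₁` is not the canonical representative of its place
(`mk ῑ₁ = mk ι₁`, `ῑ₁ ≠ ι₁`), so `SInstance.GOG V' c` fails for every hermitian space `V'` presented at `ῑ₁` and every seesaw context `c`:
the OG-guarded theta supply speaks only at the canonical `ι₁`.  Three theorems, kernel only.
-/

namespace HodgeCM

namespace SignRecipe

variable {L : CMField}

/-- `ῑ₁ ≠ ι₁`: no complex embedding of the CM field `L` is self-conjugate (`Im ι₁(η_L) ≠ 0`). [folklore] -/
theorem starRingEnd_comp_ne_self (ι₁ : L →+* ℂ) : (starRingEnd ℂ).comp ι₁ ≠ ι₁ := by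
  intro h
  have him := congrArg (fun f : L →+* ℂ => (f (eta L)).im) h
  simp only [RingHom.coe_comp, Function.comp_apply, Complex.conj_im] at him
  exact embedding_eta_im_ne_zero L ι₁ (by linarith)

/-- **The canonical representative of the place of `ι₁` is never BOTH `ι₁` and `ῑ₁`**: under the presentation of record
`hV : (mk ι₁).embedding = ι₁`, the conjugate embedding fails the canonical-representative clause (`mk ῑ₁ = mk ι₁`). [folklore] -/
theorem embedding_mk_ne_starRingEnd_comp {ι₁ : L →+* ℂ} (hV : (mk ι₁).embedding = ι₁) :
    (mk ((starRingEnd ℂ).comp ι₁)).embedding ≠ (starRingEnd ℂ).comp ι₁ := by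
  rw [show mk ((starRingEnd ℂ).comp ι₁) = mk ι₁ from mk_conjugate_eq ι₁, hV]
  exact (starRingEnd_comp_ne_self ι₁).symm

end SignRecipe

namespace Model.SInstance

variable {L : CMField}

/-- **No OG guard at the conjugate embedding over a presentation of record**: if `(mk ι₁).embedding = ι₁` then for every hermitian space
`V'` presented at `ῑ₁` and every seesaw context `c`, `¬ GOG V' c` — the OG family (`hG_GOG`, `hpos_GOG`, `SROG`, the `_r21AEOG` chain) speaks
only at the canonical representative. [folklore] -/
theorem not_GOG_starRingEnd_comp {ι₁ : L →+* ℂ} (hV : (NumberField.InfinitePlace.mk ι₁).embedding = ι₁)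
    (V' : HermSpace3 L ((starRingEnd ℂ).comp ι₁)) (c : SeesawCtx L) : ¬ GOG V' c :=
  fun h => SignRecipe.embedding_mk_ne_starRingEnd_comp hV h.1

end Model.SInstance

end HodgeCM

end
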